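import Summits.ValiantsHypothesis.ValiantsHypothesis.Theorems.GeneratorObstructionsPerGenDegreeSuperQPTwoMonomials
import Summits.ValiantsHypothesis.ValiantsHypothesis.Theorems.GeneratorObstructionsPerGenDegreeSuperQPFermatChowRay
import Summits.ValiantsHypothesis.ValiantsHypothesis.Theorems.GeneratorObstructionsPerGenDegreeSuperQPBiCollapsedPermanent

/-!
# Route GeneratorObstructions — K1 `PerGenDegreeSuperQP` (stmt-ValiantsHypothesis-11654),
# line `per-side-atoms`: every ray `j = r + p` (`r, p ∣ m`, `r ≥ 2`) of `S(per_m)` is hit —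
# `(y₁⋯y_r)^t + (w₁⋯w_p)^u = per_m(diag(y_{a(i)}) + cyclic(w_{b(i)}))`

Nineteenth support file of the line; consequences of `…TwoMonomials` (the binomial
`Q = (y₁⋯y_r)^t + (w₁⋯w_p)^u`, `r t = p u = m`, is polystable), `…FermatChowRay` (the cycle/diagonal
substitution and the two surviving permutations) and the ray criterion (`…RayCriterion`):

* `exists_linSubst_cycleDiag_labels`, `linSubst_cycleDiag_labels_perFormLex` — the linear
  endomorphism `x_{cc} ↦ y_{a(c)}`, `x_{c-1,c} ↦ w_{b(c)}`, other `x ↦ 0` (balanced labellings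
  `a : [m] → [r]`, `b : [m] → [p]`, the `y`'s placed on the diagonal, the `w`'s on cyclic
  sub-diagonal positions) carries `per_m` to `Q`: only `σ = 1` (giving `∏_i y_{a(i)} = (∏ y)^t`)
  and the backward shift (giving `∏_i w_{b(i)} = (∏ w)^u`) survive;
* `twoMonomials_mem_orbitClosure_per` — so `Q` is an `(r+p)`-variable degeneration of `per_m`;
* `per_ray_hit_add`, `per_exists_ray_atom_add` — **the ray `j = r + p` of `S(per_m)` is hit and
  carries an atom**, for all factorizations `m = r t = p u` with `r ≥ 2`.

Together with `…BiCollapsedPermanentRays` (`j = r₁ r₂`) the occurrence monoid of the permanent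
is now known to meet the chamber rays `(1^j)^*` for every `j` that is a PRODUCT or a SUM of two
divisors of `m` (sums with a summand `≥ 2`); e.g. for `m` prime: `j ∈ {1, 2, m, m+1, 2m, m²}`.
First-occurrence degrees on these rays — whose super-quasi-polynomial growth along some sequence
would be the registered `stub_atomLate` — remain open. Honest framing: unconditional structure
theorems; `stub_atomLate` (`c ≥ 2`), K1 and `GenFlipThesis` remain OPEN; nothing here bears on
VP versus VNP. References: [BurgisserIkenmeyer2017] Prop. 2.8, Def. 3.3; [MulmuleySohoni2001] §4.
-/

set_option linter.dupNamespace false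

noncomputable section

namespace Summit.ValiantsHypothesis.ValiantsHypothesis.Theorems.GeneratorObstructions.PerGenDegreeSuperQP

open MvPolynomial
open Literature.NumberTheory.DiophantineGeometry Literature.Computability.AlgebraicComplexity
  Literature.Computability.Complexity

section Degeneration

variable {m : ℕ} [NeZero m]

/-- **The labelled cycle/diagonal substitution** `x_{cc} ↦ Y(c)`, `x_{c-1,c} ↦ W(c)`, other
`x ↦ 0`, for arbitrary target variables `Y(c), W(c)`, as a linear endomorphism of the matrix
variables. [folklore] -/
theorem exists_linSubst_cycleDiag_labels (hm : 2 ≤ m) (Y W : Fin m → MatIdx m) :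
    ∃ A : Matrix (MatIdx m) (MatIdx m) ℂ, ∀ r' c : Fin m,
      linSubst (MatIdx m) ℂ A (X (toLex (r', c) : MatIdx m)) =
        if r' = c then X (Y c) else if r' + 1 = c then X (W c) else 0 := by
  classical
  have h10 := fin_one_ne_zero hm
  refine ⟨Matrix.of fun y x : MatIdx m => if (ofLex x).1 = (ofLex x).2 ∧ y = Y (ofLex x).2 then (1 : ℂ)
      else if (ofLex x).1 + 1 = (ofLex x).2 ∧ y = W (ofLex x).2 then 1 else 0, fun r' c => ?_⟩
  rw [linSubst_X]
  simp only [Matrix.of_apply, ofLex_toLex]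
  by_cases hrc : r' = c
  · subst hrc
    have hr1 : ¬ (r' + 1 = r') := fun h => h10 (by simpa using h)
    rw [if_pos rfl, Finset.sum_eq_single (Y r')]
    · simp
    · intro y _ hy
      rw [if_neg (fun h => hy h.2), if_neg (fun h => hr1 h.1), zero_smul]
    · intro h; exact absurd (Finset.mem_univ _) h
  · rw [if_neg hrc]
    by_cases hrc1 : r' + 1 = c
    · rw [if_pos hrc1, Finset.sum_eq_single (W c)]
      · rw [if_neg (fun h => hrc h.1), if_pos ⟨hrc1, rfl⟩, one_smul]
      · intro y _ hy
        rw [if_neg (fun h => hrc h.1), if_neg (fun h => hy h.2), zero_smul]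
      · intro h; exact absurd (Finset.mem_univ _) h
    · rw [if_neg hrc1]
      refine Finset.sum_eq_zero fun y _ => ?_
      rw [if_neg (fun h => hrc h.1), if_neg (fun h => hrc1 h.1), zero_smul]

/-- **`per_m` under the labelled cycle/diagonal substitution is `∏_c Y(c) + ∏_c W(c)`**: only the
identity and the backward shift survive (`eq_one_or_eq_subRight`). [folklore] -/
theorem linSubst_cycleDiag_labels_perFormLex (hm : 2 ≤ m) (Y W : Fin m → MatIdx m)
    {A : Matrix (MatIdx m) (MatIdx m) ℂ}
    (hA : ∀ r' c : Fin m, linSubst (MatIdx m) ℂ A (X (toLex (r', c) : MatIdx m)) =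
      if r' = c then X (Y c) else if r' + 1 = c then X (W c) else 0) :
    linSubst (MatIdx m) ℂ A
        (MvPolynomial.rename (toLex : Fin m × Fin m → MatIdx m) (perPoly (Fin m) ℂ)) =
      (∏ c : Fin m, X (Y c)) + ∏ c : Fin m, X (W c) := by
  classical
  have h10 := fin_one_ne_zero hm
  rw [perFormLex_eq_sum, map_sum]
  simp only [map_prod, hA]
  rw [Fintype.sum_eq_add (1 : Equiv.Perm (Fin m)) (Equiv.subRight (1 : Fin m))
    (subRight_one_ne_one hm).symm]
  · congr 1
    · simp
    · refine Finset.prod_congr rfl fun i _ => ?_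
      have hne : ¬ (i - 1 = i) := fun h => h10 (by simpa using h)
      rw [Equiv.subRight_apply, if_neg hne, if_pos (sub_add_cancel i 1)]
  · rintro σ ⟨h1, h2⟩
    have h : ¬ ∀ i, σ i = i ∨ σ i + 1 = i := by
      intro h
      rcases eq_one_or_eq_subRight hm σ h with h' | h'
      · exact h1 h'
      · exact h2 h'
    push Not at h
    obtain ⟨i, hi1, hi2⟩ := h
    exact Finset.prod_eq_zero (Finset.mem_univ i) (by rw [if_neg hi1, if_neg hi2])

end Degeneration

section Ray

variable {r p t u : ℕ}

/-- **The binomial is an `(r+p)`-variable degeneration of `per_m`** (`m = r t = p u ≥ 2`): with the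
balanced labellings `a` (of the diagonal by `r` letters) and `b` (of the cyclic sub-diagonal by
`p` letters), `per_m(diag(y_{a(i)}) + cyclic(w_{b(i)})) = ∏_i y_{a(i)} + ∏_i w_{b(i)} = (∏y)^t + (∏w)^u`;
placed with `y_c ↦ x_{cc}`, `w_s ↦ x_{s-1,s}` it lies in `End·per_m ⊆ Δ(per_m)`.
[cite: MulmuleySohoni2001, §4] -/
theorem twoMonomials_mem_orbitClosure_per (h : r * t = p * u) (hm : 2 ≤ r * t) (h₁ : r ≤ r * t)
    (h₂ : p ≤ r * t) :
    haveI : NeZero (r * t) := ⟨by omega⟩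
    MvPolynomial.rename
        (Fin.addCases (motive := fun _ => MatIdx (r * t))
          (fun c : Fin r => (toLex (Fin.castLE h₁ c, Fin.castLE h₁ c) : MatIdx (r * t)))
          (fun s : Fin p => (toLex (Fin.castLE h₂ s - 1, Fin.castLE h₂ s) : MatIdx (r * t))))
        ((∏ a : Fin r, X (Fin.castAdd p a)) ^ t + (∏ s : Fin p, X (Fin.natAdd r s)) ^ u :
          MvPolynomial (Fin (r + p)) ℂ) ∈
      orbitClosure (MvPolynomial.rename (toLex : Fin (r * t) × Fin (r * t) → MatIdx (r * t))
        (perPoly (Fin (r * t)) ℂ)) := by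
  haveI : NeZero (r * t) := ⟨by omega⟩
  haveI : Infinite ℂ := CharZero.infinite ℂ
  set κ : Fin (r + p) → MatIdx (r * t) := Fin.addCases (motive := fun _ => MatIdx (r * t))
      (fun c : Fin r => (toLex (Fin.castLE h₁ c, Fin.castLE h₁ c) : MatIdx (r * t)))
      (fun s : Fin p => (toLex (Fin.castLE h₂ s - 1, Fin.castLE h₂ s) : MatIdx (r * t))) with hκ
  obtain ⟨A, hA⟩ := exists_linSubst_cycleDiag_labels hm
    (fun c => κ (Fin.castAdd p (finProdFinEquiv.symm c).1))
    (fun c => κ (Fin.natAdd r (finProdFinEquiv.symm (Fin.cast h c)).1))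
  have hexp := linSubst_cycleDiag_labels_perFormLex hm _ _ hA
  rw [prod_comp_colLabel (a := t) (fun c' : Fin r => (X (κ (Fin.castAdd p c')) : MvPolynomial (MatIdx (r * t)) ℂ)),
    prod_comp_castLabel h (fun s : Fin p => (X (κ (Fin.natAdd r s)) : MvPolynomial (MatIdx (r * t)) ℂ))]
    at hexp
  have hq : MvPolynomial.rename κ
        ((∏ a : Fin r, X (Fin.castAdd p a)) ^ t + (∏ s : Fin p, X (Fin.natAdd r s)) ^ u :
          MvPolynomial (Fin (r + p)) ℂ) =
      (∏ c' : Fin r, X (κ (Fin.castAdd p c'))) ^ t + (∏ s : Fin p, X (κ (Fin.natAdd r s))) ^ u := by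
    simp [map_add, map_pow, map_prod, rename_X]
  rw [hq, ← hexp]
  exact endOrbit_subset_orbitClosure_holds (k := ℂ) (σ := MatIdx (r * t)) _ ⟨A, rfl⟩

/-- **The ray `j = r + p` is hit** (`m = r t = p u`, `r ≥ 2`, `p, t, u ≥ 1`): `(k^{r+p})^*` occurs in
`ℂ[Δ_m[per_m]]` for some `k ≥ 1` — the binomial `(y₁⋯y_r)^t + (w₁⋯w_p)^u` is a polystable, hence
`SL_{r+p}`-semistable, `(r+p)`-variable degeneration of `per_m`; then the ray criterion. These rays
(sums of two divisors of `m`) are in general neither Chow rays nor of the product form `r₁r₂`.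
[cite: BurgisserIkenmeyer2017, Prop. 2.8 and Def. 3.3] -/
theorem per_ray_hit_add (h : r * t = p * u) (hr : 2 ≤ r) (hp : 0 < p) (ht : 0 < t) (hu : 0 < u) :
    ∃ k : ℕ, 0 < k ∧
      highestWeightSpace (orbitCoordRep (MvPolynomial.rename toLex (perPoly (Fin (r * t)) ℂ)) (r * t))
        (partitionWeightLex (r * t) (Nat.Partition.rectangle (r + p) k)) ≠ ⊥ := by
  have h₁ : r ≤ r * t := Nat.le_mul_of_pos_right r ht
  have h₂ : p ≤ r * t := h ▸ Nat.le_mul_of_pos_right p hu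
  have hm : 2 ≤ r * t := le_trans hr h₁
  haveI : NeZero (r * t) := ⟨by omega⟩
  have h10 : (1 : Fin (r * t)) ≠ 0 := fin_one_ne_zero hm
  have hκ : Function.Injective (Fin.addCases (motive := fun _ => MatIdx (r * t))
      (fun c : Fin r => (toLex (Fin.castLE h₁ c, Fin.castLE h₁ c) : MatIdx (r * t)))
      (fun s : Fin p => (toLex (Fin.castLE h₂ s - 1, Fin.castLE h₂ s) : MatIdx (r * t)))) := by
    intro x x' hxx
    obtain ⟨y, rfl⟩ := finSumFinEquiv.surjective x
    obtain ⟨y', rfl⟩ := finSumFinEquiv.surjective x'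
    rcases y with a | s <;> rcases y' with a' | s' <;>
      simp only [finSumFinEquiv_apply_left, finSumFinEquiv_apply_right, Fin.addCases_left,
        Fin.addCases_right] at hxx ⊢
    · have h1 := congrArg (fun z : MatIdx (r * t) => (ofLex z).1) hxx
      simp only [ofLex_toLex] at h1
      rw [Fin.castLE_injective h₁ h1]
    · exfalso
      have h1 := congrArg (fun z : MatIdx (r * t) => (ofLex z).1) hxx
      have h2 := congrArg (fun z : MatIdx (r * t) => (ofLex z).2) hxx
      simp only [ofLex_toLex] at h1 h2
      rw [h2] at h1
      exact h10 (by simpa using h1.symm)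
    · exfalso
      have h1 := congrArg (fun z : MatIdx (r * t) => (ofLex z).1) hxx
      have h2 := congrArg (fun z : MatIdx (r * t) => (ofLex z).2) hxx
      simp only [ofLex_toLex] at h1 h2
      rw [← h2] at h1
      exact h10 (by simpa using h1)
    · have h2 := congrArg (fun z : MatIdx (r * t) => (ofLex z).2) hxx
      simp only [ofLex_toLex] at h2
      rw [Fin.castLE_injective h₂ h2]
  obtain ⟨k, hk, hocc⟩ := exists_hasHighestWeight_rectangle_of_isSLSemistable_projection
    (matIdxEquiv (r * t)) (show r * t ≠ 0 by omega) (perFormLex_isHomogeneous (r * t))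
    (show 0 < r + p by omega) _ hκ
    (twoMonomials_isHomogeneous rfl h.symm) (twoMonomials_mem_orbitClosure_per h hm h₁ h₂)
    ((isPolystable_twoMonomials hr ht hu rfl h.symm).isSLSemistable
      (twoMonomials_ne_zero (p := p) (u := u) (by omega) ht))
  exact ⟨k, hk, hocc⟩

/-- **The ray `j = r + p` carries an atom** (`m = r t = p u`, `r ≥ 2`, `p, t, u ≥ 1`).
[cite: BurgisserIkenmeyer2017, Prop. 2.8 and Def. 3.3] -/
theorem per_exists_ray_atom_add (h : r * t = p * u) (hr : 2 ≤ r) (hp : 0 < p) (ht : 0 < t)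
    (hu : 0 < u) :
    ∃ k₀ : ℕ, 0 < k₀ ∧
      highestWeightSpace (orbitCoordRep (MvPolynomial.rename toLex (perPoly (Fin (r * t)) ℂ)) (r * t))
        (partitionWeightLex (r * t) (Nat.Partition.rectangle (r + p) k₀)) ≠ ⊥ ∧
      (∀ k : ℕ, 0 < k → k < k₀ →
        highestWeightSpace (orbitCoordRep (MvPolynomial.rename toLex (perPoly (Fin (r * t)) ℂ)) (r * t))
          (partitionWeightLex (r * t) (Nat.Partition.rectangle (r + p) k)) = ⊥) ∧
      (∀ χ₁ χ₂ : Weight (MatIdx (r * t)),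
        χ₁ + χ₂ = partitionWeightLex (r * t) (Nat.Partition.rectangle (r + p) k₀) →
        χ₁ ≠ 0 → χ₂ ≠ 0 →
        highestWeightSpace (orbitCoordRep (MvPolynomial.rename toLex (perPoly (Fin (r * t)) ℂ)) (r * t)) χ₁ = ⊥ ∨
          highestWeightSpace (orbitCoordRep (MvPolynomial.rename toLex (perPoly (Fin (r * t)) ℂ)) (r * t)) χ₂ = ⊥) := by
  have h₁ : r ≤ r * t := Nat.le_mul_of_pos_right r ht
  have h₂ : p ≤ r * t := h ▸ Nat.le_mul_of_pos_right p hu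
  exact exists_least_rectangle_atom _ _ (by omega) (by nlinarith) (per_ray_hit_add h hr hp ht hu)

end Ray

end Summit.ValiantsHypothesis.ValiantsHypothesis.Theorems.GeneratorObstructions.PerGenDegreeSuperQP

end
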